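import Summits.CriticalPhenomena.PercolationContinuityZ3.Theorems.Transplant.SkelPhiConcRealised
import Summits.CriticalPhenomena.PercolationContinuityZ3.Theorems.Transplant.SkelPhiConcScheduleN
import Summits.CriticalPhenomena.PercolationContinuityZ3.Theorems.Transplant.SkelPhiCellsWeakGV
import Summits.CriticalPhenomena.PercolationContinuityZ3.Theorems.Transplant.SkelPhiCellsWeakG
import Summits.CriticalPhenomena.PercolationContinuityZ3.Theorems.Transplant.SkelPhiNegRealised
import Literature.Probability.Percolation.OrientedHistorySiteRenormalizationRun
import Summits.CriticalPhenomena.PercolationContinuityZ3.Theorems.Transplant.SkelConcRealisedO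
import Summits.CriticalPhenomena.PercolationContinuityZ3.Theorems.Transplant.KNCells2SchemeO
import Summits.CriticalPhenomena.PercolationContinuityZ3.Theorems.Transplant.KNCellsSchemeO
import Summits.CriticalPhenomena.PercolationContinuityZ3.Theorems.Transplant.PlanarCells2VDefs
import HarnessLib
/-!
J23/(R-45) SUCCESSOR `…V` (hp-8 g42, 2026-08-23; ruling lead g12 11:31:15Z, design owner p3-g17 (R-44)/(R-45)): the twin of `SkelPhiNegRealisedT` over the cell structure with
per-axis ASYMMETRIC transverse rooms `PCells2V` (PlanarCells2VDefs: the slab family `Stub/Zone/Face/Hfull/faceLo/faceHi` has transverse interval `σ·[−hB∥, hF∥]`,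
`hB, hF ≤ 2r⊥`, instead of `[−2r⊥, 2r⊥]`; every other box verbatim); statements and proofs VERBATIM with `PCells2T ↦ PCells2V` (+ the renames of record of the
V layer below it); the only mathematical touch points are the places that read the symmetric transverse room (listed in the lane line of this file's landing).
NO landed file is edited; `SkelPhiNegRealisedT` stays valid (it is the instance `PCells2T.toV`, `hB = hF = 2r⊥`). NON-VACUITY: inherited verbatim from `SkelPhiNegRealisedT` (same witness line).

(R-40) SUCCESSOR `…T` (hp-8 g42, 2026-08-23; ruling p3-g16 06:23:56Z, J18): the twin of `SkelPhiNegRealisedS` over the PER-AXIS creep cap `PCells2V` (PlanarCells2TDefs: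
`c i ≤ r (oth i)` instead of the uniform `c i ≤ cmax ≤ r j`); statements and proofs VERBATIM with `PCells2S ↦ PCells2V` (+ the renames of record of the T layer below it);
the only mathematical touch points are the places that read the cap, which only ever need the cross form `c (oth j) ≤ r j` (listed in the lane line of this file's landing).
NO landed file is edited; `SkelPhiNegRealisedS` stays valid (and is an instance of this file through `PCells2S.toT`). NON-VACUITY: inherited verbatim from `SkelPhiNegRealisedS` (same witness line).

# N2 (frames-only node `SamePDropOfSkeletonFrm₁`, OPEN) — WAVE 1, (F) face-data column over STAGGERED cells ((R-22) `PCells2V`, (R-28)(β) one landing per file): the twin of N1's `SkelPhiNegRealised`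

builds on p205010 (kernel theorem, internal audit signed; external expert review pending) — nothing in this file uses p205010; NOTHING is claimed about the
open node `SamePDropOfSkeletonFrm₁` (`SamePDropOfSkeletonNeg₁` is CLOSED in the tree and untouched by this file).
Status sentence (coordinator 2026-08-20T04:30Z): "θ(p_c) = 0 on ℤ^d, all d ≥ 2 — kernel-verified (Lean 4/Mathlib, standard axioms); internal adversarial
audit SIGNED 2026-08-20 04:29Z; external expert review pending."
Lane `prim-bschramm`, seat `prim-hp-8` (gen 40); helper file (`--supports stmt-CriticalPhenomena-4575 --as helper`); design owner p3-g15 ((R-22) staggered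
cells `PCells2V`, (R-27)/(R-29) far regions of record `FarNS/FarNS₂`, (R-28)(β), naming 2026-08-22T23:00:04Z: suffix `S`).
PORT RULES (HOME/prim-hp-8/code/gen40/orient/bin/port_s.py = stmt-g19's port_orient.py + the G token table): the cells are `P : PCells2V`, every box is
read about the STAGGERED centre `cenS` (`PlanarCells2SDefs/SFar/ContainS/SArm/SepS/SepInfS/LevelsS/EfarN2S`), the scheme record is `cellGeomSG₂V`/`cellGeomSG₂bV`
(`SkelPhiCellsWeakGS/…SmallMS`: narrow arm `BtwNS`, two-block far region `FarNS₂`), the history-site API is the ORIENTED one at `qNE` where it occurs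
(`ochoice qNE`, `onwardO`, `Valid₂O`, `IsRun₂O`, …, (R-18)); EVERY declaration is re-declared with the suffix `S` (same namespace). Docstrings/citations are N1's.
N1 HEADER (kept for the reader):
* `cellGeomSG₂_anchor`, `cellGeomSG₂_a₀` (`rfl`), **`realised_of_choice_SG₂`**, **`tgt_add_stepVec_ne_zero₂`**, and **`reach_radii_concSG₂N`**:
  at a chosen edge `e = (v → x)`, `α = aOf₁`, `β = aOf₂`, onward `du`, `E := Erad (nQ α x)`: `rQ α x = E`, `rB α v δ = E`, `ρ β x du ℓ = E − 2`,
  `rE β x du = Frad (nQ α x + 1) − 1`, `rM β (x+du) = Frad (nQ α x + 1) − L'`, `nQ α x = nS α v + 1`.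
[cite: KozmaNitzan2024, §4 pp. 25–27 (the exploration process), p. 31 (the corridor step)]
-/
noncomputable section

open scoped Classical

namespace Summit.CriticalPhenomena.PercolationContinuityZ3.Theorems

namespace Transplant

namespace Skelφ

open Literature.Probability.Percolation Literature.Probability.LatticeModels SimpleGraph GadgetSystem Contour KNCells
open Literature.Probability.Percolation.KozmaNitzan.Cells (stepVec_apply_fst stepVec_apply_oth)
open BoxProdZ2 (Realised ConcRadiiG nQ nS gen0 Erad Frad gen0_stepVec gen0_stepVec_add_stepVec)
open Skel (realised_of_choice realised_of_choiceO l1_tgt_le_nQ l1_tgt_le_nQO nQ_tgt_eq_nS_src_succ nQ_tgt_eq_nS_src_succO)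

variable {V : Type} [DecidableEq V] {G : SimpleGraph V} [G.LocallyFinite] {φ : V → Site 2}

/-! ## §1 The anchors of `cellGeomSG₂` -/

section SG

variable (G φ) (P : PCells2V) (t : V) (Λ : ConcRadiiG) (q : unitInterval) (δc : ℝ)

/-- The re-centring rule of `cellGeomSG₂V` is `a ↦ a + 1`. [folklore] -/
theorem cellGeomSG₂_anchorV : ∀ a v Q, (⟨cellGeomSG₂V G φ P t Λ, q, δc⟩ : KSchA V ℕ).Γ.anchor a v Q = a + 1 := fun _ _ _ => rfl

/-- The root anchor of `cellGeomSG₂V` is `0`. [folklore] -/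
theorem cellGeomSG₂_a₀V : (⟨cellGeomSG₂V G φ P t Λ, q, δc⟩ : KSchA V ℕ).Γ.a₀ = 0 := rfl

variable {G φ P t Λ q δc}

/-- **The anchors of a chosen edge of the N1 scheme of record are realised.** [folklore] -/
theorem realised_of_choice_SG₂V [Countable V] (h : ProbeHistory V) {e : Site 2 × MDir}
    (hc : ((⟨cellGeomSG₂V G φ P t Λ, q, δc⟩ : KSchA V ℕ).astOf₂O G h).st.ochoice KSchA.qNE = some e) :
    Realised ((⟨cellGeomSG₂V G φ P t Λ, q, δc⟩ : KSchA V ℕ).aOf₁O G h e) ((⟨cellGeomSG₂V G φ P t Λ, q, δc⟩ : KSchA V ℕ).aOf₂O G h e) (tgt e) :=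
  realised_of_choiceO (cellGeomSG₂_anchorV G φ P t Λ q δc) (cellGeomSG₂_a₀V G φ P t Λ q δc) h hc

/-- **Onward targets are never the root cell** (root footprint `φ t = 0`): after a valid history the root is explored, so the column of the root
cell is not onward. [cite: KozmaNitzan2024, §4 p. 27 ((29))] -/
theorem tgt_add_stepVec_ne_zero₂V [Countable V] (hφ : φ t = 0) {h : ProbeHistory V} {e : Site 2 × MDir}
    (hV : (⟨cellGeomSG₂V G φ P t Λ, q, δc⟩ : KSchA V ℕ).Valid₂O G h e) {du : MDir}
    (hdu : du ∈ (⟨cellGeomSG₂V G φ P t Λ, q, δc⟩ : KSchA V ℕ).onwardO G h (tgt e)) : tgt e + stepVec du ≠ 0 := by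
  intro h0
  have hroot := hV.root_mem
  have hon := (Finset.mem_filter.1 (Finset.mem_filter.1 hdu).1).2 _ hroot
  apply hon
  show φ t = P.cenS (tgt e + stepVec du)
  rw [h0, PCells2T.cenS_zero, hφ]

/-- The norm of a chosen target is below its cube count: `‖tgt e‖₁ ≤ nQ α (tgt e)` (`cellGeomSG₂V`). [folklore] -/
theorem l1_tgt_le_nQ₂V [Countable V] (h : ProbeHistory V) {e : Site 2 × MDir}
    (hc : ((⟨cellGeomSG₂V G φ P t Λ, q, δc⟩ : KSchA V ℕ).astOf₂O G h).st.ochoice KSchA.qNE = some e) :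
    ((tgt e) 0).natAbs + ((tgt e) 1).natAbs ≤ nQ ((⟨cellGeomSG₂V G φ P t Λ, q, δc⟩ : KSchA V ℕ).aOf₁O G h e) (tgt e) :=
  l1_tgt_le_nQO (cellGeomSG₂_anchorV G φ P t Λ q δc) (cellGeomSG₂_a₀V G φ P t Λ q δc) h hc

end SG

/-! ## §2 The (C) habitat radii at a chosen edge, over `concRadii2N` -/

section ReachRadii

variable {P : PCells2V} {t : V} {gap gap' : ℕ → ℕ} {E₀ L' : ℕ} {off : Site 2 → ℕ} {q : unitInterval} {δc : ℝ}

/-- **The (C) habitat radii at a chosen edge of the N1 scheme of record** over `Λ = concRadii2N P.toPCells2 gap gap' E₀ L' off` (`20·rmax ≤ gap`, the slot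
linearly bounded `off x ≤ c·‖x‖₁ + 1` with `c ≤ gap`, `1 ≤ E₀`, root footprint `0`): with `E := Erad (nQ α x)`, `rQ α x = E`, `rB α v δ = E`,
`ρ β x du ℓ = E − 2`, `rE β x du = Frad (nQ α x + 1) − 1`, `rM β (x+du) = Frad (nQ α x + 1) − L'`, `nQ α x = nS α v + 1`. [this work] -/
theorem reach_radii_concSG₂NV [Countable V] (hgap : ∀ n, 20 * P.rmax ≤ gap n) {c : ℕ} (hgapc : ∀ n, c ≤ gap n)
    (hoff : ∀ x : Site 2, off x ≤ c * ((x 0).natAbs + (x 1).natAbs) + 1) (hE₀ : 1 ≤ E₀) (hφ : φ t = 0)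
    {h : ProbeHistory V} {e : Site 2 × MDir}
    (hc : ((⟨cellGeomSG₂V G φ P t (concRadii2N P.toPCells2 gap gap' E₀ L' off), q, δc⟩ : KSchA V ℕ).astOf₂O G h).st.ochoice KSchA.qNE = some e)
    (hV : (⟨cellGeomSG₂V G φ P t (concRadii2N P.toPCells2 gap gap' E₀ L' off), q, δc⟩ : KSchA V ℕ).Valid₂O G h e) {du : MDir}
    (hdu : du ∈ (⟨cellGeomSG₂V G φ P t (concRadii2N P.toPCells2 gap gap' E₀ L' off), q, δc⟩ : KSchA V ℕ).onwardO G h (tgt e)) :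
    let α := (⟨cellGeomSG₂V G φ P t (concRadii2N P.toPCells2 gap gap' E₀ L' off), q, δc⟩ : KSchA V ℕ).aOf₁O G h e
    let β := (⟨cellGeomSG₂V G φ P t (concRadii2N P.toPCells2 gap gap' E₀ L' off), q, δc⟩ : KSchA V ℕ).aOf₂O G h e
    (concRadii2N P.toPCells2 gap gap' E₀ L' off).rQ α (tgt e) = Erad gap gap' E₀ (nQ α (tgt e)) ∧
    (concRadii2N P.toPCells2 gap gap' E₀ L' off).rB α e.1 e.2 = Erad gap gap' E₀ (nQ α (tgt e)) ∧
    (∀ ℓ, (concRadii2N P.toPCells2 gap gap' E₀ L' off).ρ β (tgt e) du ℓ = Erad gap gap' E₀ (nQ α (tgt e)) - 2) ∧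
    (concRadii2N P.toPCells2 gap gap' E₀ L' off).rE β (tgt e) du = Frad gap gap' E₀ (nQ α (tgt e) + 1) - 1 ∧
    (concRadii2N P.toPCells2 gap gap' E₀ L' off).rM β (tgt e + stepVec du) = Frad gap gap' E₀ (nQ α (tgt e) + 1) - L' ∧
    nQ α (tgt e) = nS α e.1 + 1 := by
  intro α β
  have hreal : Realised α β (tgt e) := realised_of_choice_SG₂V h hc
  have hy : tgt e + stepVec du ≠ 0 := tgt_add_stepVec_ne_zero₂V hφ hV hdu
  obtain ⟨h1, h2, h3⟩ := hreal.sched_hyps hy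
  refine ⟨?_, rfl, fun ℓ => ?_, ?_, ?_, ?_⟩
  · exact concRadii2N_rQ_eq_of_norm_le P.toPCells2 gap' E₀ L' off hgap hgapc hE₀ (l1_tgt_le_nQ₂V h hc) (hoff _)
  · rw [concRadii2N_ρ_eq P.toPCells2 gap gap' E₀ L' off h1 h2 ℓ, hreal.nS_eq]
  · rw [concRadii2N_rE_eq P.toPCells2 gap gap' E₀ L' off h3, hreal.nS_eq]
  · rw [concRadii2N_rM, hreal.nQ_add_stepVec hy]
  · exact nQ_tgt_eq_nS_src_succO (cellGeomSG₂_anchorV G φ P t _ q δc) (cellGeomSG₂_a₀V G φ P t _ q δc) h hc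

end ReachRadii

end Skelφ

end Transplant

end Summit.CriticalPhenomena.PercolationContinuityZ3.Theorems

end
-- build-touch 2026-08-25T04:20Z T1 (lead g17): re-land of p381234, declarations byte-identical
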